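import Literature.Analysis.FluidPDE.WeylLemmaBall
import Literature.Analysis.FluidPDE.WeaklyHarmonicInteriorBound
import Literature.Analysis.FluidPDE.PressureSliceDecay
import HarnessLib

/-!
# Scale-invariant interior Lipschitz and mean-oscillation bounds for weakly harmonic functions

Analysis/FluidPDE support file (theorems only, no definitions, no named facts) on the discharge
path of the named fact `Literature.Analysis.FluidPDE.RRS2016.lemma15_12`
(`CKNLocalRegularityRRS.lean`: Robinson–Rodrigo–Sadowski 2016, Lemma 15.12, the local pressure
estimate of the Caffarelli–Kohn–Nirenberg theory). In the printed proof (pp. 233–234) the parts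
`p₂`, `p₃` of the localised pressure, whose data live on the shell `3ρ/4 ≤ |y| ≤ ρ`, are
controlled on `B_r`, `r ≤ ρ/2`, "by estimating their gradients and using the Mean Value
Theorem": `‖∇p₂‖_{L^∞(B_r)} ≤ c ρ⁻⁴ ∫_{B_ρ} |u|²`, whence
`‖p₂ - (p₂)_r‖_{L^{3/2}(B_r)} ≤ c r³ ‖∇p₂‖_{L^∞(B_r)}` ((15.36)–(15.37)). In the tree's rendering of
that proof the rôle of `p₂ + p₃` is played by the **weakly harmonic** remainder `h = p - P` of the
pressure after subtraction of a whole-space pressure (as in `PressureSliceDecay`), and the two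
displayed steps become the following statements about an `L¹` function `h` on `B(c, ρ)` with
`∫ h Δφ = 0` for all `φ ∈ C_c^∞(B(c, ρ))`:

* `exists_lipschitz_rep_of_weaklyHarmonic_scale` — **interior Lipschitz estimate at scale `ρ`**:
  a universal `K` such that `h` agrees a.e. on `B(c, ρ/2)` with a continuous `H'` satisfying
  `|H'(x) - H'(z)| ≤ K ρ⁻⁴ (∫_{B(c,ρ)} |h|) |x - z|` (Gilbarg–Trudinger, Thm. 2.10:
  `sup_{B_{ρ/2}} |∇h| ≤ C ρ⁻⁴ ‖h‖_{L¹(B_ρ)}`; here from the tree's Weyl lemma on a ball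
  `WeylLemmaBall.ae_eq_newtonFarSmoothing_indicator` with the weight `λ^{ρ/4, ρ/2}` and the
  scaling `‖Dλ^{c,2c}‖ ≤ c⁻⁴ sup‖Dλ^{1,2}‖`);
* `exists_lintegral_oscillation_le_of_weaklyHarmonic` — **mean oscillation in `L^{3/2}`**: a
  universal `C` with
  `∫_{B(c,r)} |h - (h)_{B(c,r)}|^{3/2} ≤ C (r/ρ)^{9/2} ∫_{B(c,ρ)} |h|^{3/2}` for `0 < r`, `2r ≤ ρ`
  (the Lipschitz bound gives `|h - (h)_r| ≤ 2r · Kρ⁻⁴ ∫_{B_ρ}|h|` a.e. on `B_r`, and Hölder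
  `(∫_{B_ρ}|h|)^{3/2} ≤ |B_ρ|^{1/2} ∫_{B_ρ}|h|^{3/2}`), written with `r^{9/2}/ρ^{9/2}` as in the
  third term of `RRS2016.lemma15_12`.

## Mathlib / tree

Tree (all used): `WeylLemmaBall.ae_eq_newtonFarSmoothing_indicator`,
`WeylLemmaBall.abs_newtonFarSmoothing_sub_le`, `WeylLemmaBall.continuous_newtonFarSmoothing'`
(`WeylLemmaBall`), `newtonFarLaplacian_scale` (`NewtonPotential`),
`exists_bound_fderiv_newtonFarLaplacian` (`HarmonicBallMeanValue`), `fderiv_const_smul_comp_smul`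
(`HarmonicProbe`), `integral_abs_indicator_ball` (`WeaklyHarmonicInteriorBound`),
`lintegral_enorm_rpow_threeHalves_le` (`PressureSliceDecay`). Mathlib: `setAverage_eq`,
`average_congr`, `norm_setIntegral_le_of_norm_le_const`, `Measure.addHaar_ball_of_pos`.

## References

* J. C. Robinson, J. L. Rodrigo, W. Sadowski, *The three-dimensional Navier–Stokes equations*,
  Cambridge Studies in Advanced Mathematics 157 (2016), proof of Lemma 15.12, pp. 233–234,
  (15.36)–(15.37). [RobinsonRodrigoSadowski2016]
* D. Gilbarg, N. S. Trudinger, *Elliptic partial differential equations of second order*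
  (2001), Thm. 2.10 (interior derivative estimates). [GilbargTrudinger2001]
-/

noncomputable section

open MeasureTheory Set Function Filter Topology TopologicalSpace Metric
open scoped ENNReal NNReal ContDiff Laplacian

namespace Literature.Analysis.FluidPDE

/-! ### The gradient of the weight `λ^{c, 2c}` -/

/-- **Scaling of the gradient bound for `λ`**: `‖Dλ^{c,2c}(z)‖ ≤ c⁻⁴ M` whenever
`‖Dλ^{1,2}‖ ≤ M` (`λ^{c,2c}(z) = c⁻³ λ^{1,2}(c⁻¹ z)`, `newtonFarLaplacian_scale`, and the chain
rule for dilations, `fderiv_const_smul_comp_smul`). A private copy of the tree's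
`norm_fderiv_newtonFarLaplacian_scale_le` (`TaoLocalVelocityGradient`, radii `(r, 2r)`), kept
local to avoid that file's heavy imports. [folklore] -/
private theorem norm_fderiv_newtonFarLaplacian_dilate_le {c M : ℝ} (hc : 0 < c)
    (hM : ∀ z : (EuclideanSpace ℝ (Fin 3)), ‖fderiv ℝ (newtonFarLaplacian 1 2) z‖ ≤ M) (z : (EuclideanSpace ℝ (Fin 3))) :
    ‖fderiv ℝ (newtonFarLaplacian (c * 1) (c * 2)) z‖ ≤ c⁻¹ ^ 4 * M := by
  have hM0 : 0 ≤ M := (norm_nonneg _).trans (hM 0)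
  have e : newtonFarLaplacian (c * 1) (c * 2) =
      fun w : (EuclideanSpace ℝ (Fin 3)) => (c⁻¹ ^ 3) • newtonFarLaplacian 1 2 (c⁻¹ • w) := by
    funext w
    rw [newtonFarLaplacian_scale hc, smul_eq_mul]
  rw [e, fderiv_const_smul_comp_smul _ _ (inv_ne_zero hc.ne')]
  dsimp only
  rw [norm_smul, Real.norm_eq_abs, abs_of_pos (by positivity),
    show c⁻¹ ^ 3 * c⁻¹ = c⁻¹ ^ 4 by ring]
  exact mul_le_mul_of_nonneg_left (hM _) (by positivity)

/-! ### The interior Lipschitz estimate at scale `ρ` -/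

/-- **Weyl's lemma on a ball with the scale-invariant Lipschitz estimate** (Gilbarg–Trudinger
2001, Thm. 2.10, `sup_{B_{ρ/2}} |∇h| ≤ C ρ⁻⁴ ‖h‖_{L¹(B_ρ)}` for harmonic `h`, in the a.e. form
for weakly harmonic `L¹` functions). There is a universal `K ≥ 0` such that every `h`
integrable on `B(c, ρ)` with `∫ h Δφ = 0` for all `φ ∈ C_c^∞(ℝ³)` supported in `B(c, ρ)` agrees
a.e. on `B(c, ρ/2)` with a continuous `H'` satisfying
`|H'(x) - H'(z)| ≤ K ρ⁻⁴ (∫_{B(c,ρ)} |h|) |x - z|` for all `x, z` — namely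
`H' = λ^{ρ/4,ρ/2} ⋆ (1_{B(c,ρ)} h)`. [cite: GilbargTrudinger2001, Thm. 2.10] -/
theorem exists_lipschitz_rep_of_weaklyHarmonic_scale :
    ∃ K : ℝ, 0 ≤ K ∧ ∀ (c : (EuclideanSpace ℝ (Fin 3))) (ρ : ℝ) (H : (EuclideanSpace ℝ (Fin 3)) → ℝ), 0 < ρ → IntegrableOn H (ball c ρ) volume →
      (∀ φ : (EuclideanSpace ℝ (Fin 3)) → ℝ, ContDiff ℝ (⊤ : ℕ∞) φ → HasCompactSupport φ → tsupport φ ⊆ ball c ρ →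
        ∫ x, H x * (Δ φ) x = 0) →
      ∃ H' : (EuclideanSpace ℝ (Fin 3)) → ℝ, Continuous H' ∧ H =ᵐ[volume.restrict (ball c (ρ / 2))] H' ∧
        ∀ x z, |H' x - H' z| ≤ K * (ρ ^ 4)⁻¹ * (∫ y in ball c ρ, |H y|) * ‖x - z‖ := by
  obtain ⟨M₁, hM₁0, hM₁⟩ := exists_bound_fderiv_newtonFarLaplacian
    (r₀ := (1 : ℝ)) (r₁ := 2) one_pos one_lt_two
  refine ⟨4 ^ 4 * M₁, by positivity, fun c ρ H hρ hH hharm => ?_⟩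
  have h₀ : 0 < ρ / 4 * 1 := by positivity
  have h₁ : ρ / 4 * 1 < ρ / 4 * 2 := by linarith
  set G : (EuclideanSpace ℝ (Fin 3)) → ℝ := (ball c ρ).indicator H with hG
  have hGi : Integrable G := hH.integrable_indicator measurableSet_ball
  -- weak harmonicity in the set-integral form of `WeylLemmaBall`
  have hharm' : ∀ φ : (EuclideanSpace ℝ (Fin 3)) → ℝ,
      FunctionSpaces.IsTestFunctionOn (⟨ball c ρ, isOpen_ball⟩ : Opens (EuclideanSpace ℝ (Fin 3))) φ →
        ∫ x in ball c ρ, H x * (Δ φ) x = 0 := by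
    intro φ hφ
    rw [setIntegral_eq_integral_of_forall_compl_eq_zero]
    · exact hharm φ hφ.contDiff hφ.hasCompactSupport hφ.tsupport_subset
    · intro x hx
      have hx' : x ∉ tsupport φ := fun h => hx (hφ.tsupport_subset h)
      rw [laplacian_eq_zero_of_notMem_tsupport hx', mul_zero]
  have hae := WeylLemmaBall.ae_eq_newtonFarSmoothing_indicator h₀ h₁ hH hharm'
  have hMc : ∀ z : (EuclideanSpace ℝ (Fin 3)),
      ‖fderiv ℝ (newtonFarLaplacian (ρ / 4 * 1) (ρ / 4 * 2)) z‖ ≤ (ρ / 4)⁻¹ ^ 4 * M₁ :=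
    norm_fderiv_newtonFarLaplacian_dilate_le (by positivity) hM₁
  refine ⟨newtonFarSmoothing (ρ / 4 * 1) (ρ / 4 * 2) G,
    WeylLemmaBall.continuous_newtonFarSmoothing' h₀ h₁ hGi, ?_, fun x z => ?_⟩
  · have e : ρ - ρ / 4 * 2 = ρ / 2 := by ring
    rw [← e]
    exact hae
  · have e : (ρ / 4)⁻¹ ^ 4 * M₁ = 4 ^ 4 * M₁ * (ρ ^ 4)⁻¹ := by
      field_simp
    calc |newtonFarSmoothing (ρ / 4 * 1) (ρ / 4 * 2) G x -
          newtonFarSmoothing (ρ / 4 * 1) (ρ / 4 * 2) G z|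
        ≤ (ρ / 4)⁻¹ ^ 4 * M₁ * (∫ y, |G y|) * ‖x - z‖ :=
          WeylLemmaBall.abs_newtonFarSmoothing_sub_le h₀ h₁ hGi hMc x z
      _ = 4 ^ 4 * M₁ * (ρ ^ 4)⁻¹ * (∫ y in ball c ρ, |H y|) * ‖x - z‖ := by
          rw [e, hG, integral_abs_indicator_ball]

/-! ### The mean oscillation in `L^{3/2}` -/

/-- Exponent bookkeeping: `(2rK/ρ⁴)^{3/2} (ρ³)^{1/2} r³ = (2K)^{3/2} r^{9/2}/ρ^{9/2}`. [folklore] -/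
theorem rpow_oscillation_bookkeeping {K r ρ : ℝ} (hK : 0 ≤ K) (hr : 0 < r) (hρ : 0 < ρ) :
    (2 * r * K * (ρ ^ 4)⁻¹) ^ (3 / 2 : ℝ) * (ρ ^ 3) ^ (1 / 2 : ℝ) * r ^ 3 =
      (2 * K) ^ (3 / 2 : ℝ) * (r ^ (9 / 2 : ℝ) / ρ ^ (9 / 2 : ℝ)) := by
  have e1 : 2 * r * K * (ρ ^ 4)⁻¹ = (2 * K) * (r * (ρ ^ 4)⁻¹) := by ring
  have hA : (r * (ρ ^ 4)⁻¹) ^ (3 / 2 : ℝ) = r ^ (3 / 2 : ℝ) * (ρ ^ (6 : ℝ))⁻¹ := by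
    rw [Real.mul_rpow hr.le (by positivity), Real.inv_rpow (by positivity),
      ← Real.rpow_natCast ρ 4, ← Real.rpow_mul hρ.le]
    norm_num
  have hB : (ρ ^ 3) ^ (1 / 2 : ℝ) = ρ ^ (3 / 2 : ℝ) := by
    rw [← Real.rpow_natCast ρ 3, ← Real.rpow_mul hρ.le]
    norm_num
  have hC : (r ^ 3 : ℝ) = r ^ (3 : ℝ) := by
    rw [← Real.rpow_natCast r 3]
    norm_num
  have hr9 : r ^ (9 / 2 : ℝ) = r ^ (3 / 2 : ℝ) * r ^ (3 : ℝ) := by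
    rw [← Real.rpow_add hr]; norm_num
  have hρ6 : ρ ^ (6 : ℝ) = ρ ^ (9 / 2 : ℝ) * ρ ^ (3 / 2 : ℝ) := by
    rw [← Real.rpow_add hρ]; norm_num
  have h1 : 0 < ρ ^ (9 / 2 : ℝ) := Real.rpow_pos_of_pos hρ _
  have h2 : 0 < ρ ^ (3 / 2 : ℝ) := Real.rpow_pos_of_pos hρ _
  rw [e1, Real.mul_rpow (by positivity) (by positivity), hA, hB, hC, hr9, hρ6]
  field_simp

/-- **Mean oscillation of a weakly harmonic function in `L^{3/2}`** (the estimate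
`‖p₂ - (p₂)_r‖_{L^{3/2}(B_r)} ≤ c r³ ‖∇p₂‖_{L^∞(B_r)} ≤ …` of Robinson–Rodrigo–Sadowski 2016,
(15.36)–(15.37), for a weakly harmonic `L¹` function in place of the explicit potentials).
There is a universal `C` such that for `h` integrable on `B(c, ρ)` with `∫ h Δφ = 0` for all
`φ ∈ C_c^∞(ℝ³)` supported in `B(c, ρ)`, and `0 < r`, `2r ≤ ρ`,
`∫_{B(c,r)} |h - ⨍_{B(c,r)} h|^{3/2} ≤ C (r^{9/2}/ρ^{9/2}) ∫_{B(c,ρ)} |h|^{3/2}`.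
[cite: RobinsonRodrigoSadowski2016, proof of Lemma 15.12, (15.36)–(15.37) pp. 233–234] -/
theorem exists_lintegral_oscillation_le_of_weaklyHarmonic :
    ∃ C : ℝ≥0, ∀ (c : (EuclideanSpace ℝ (Fin 3))) (ρ r : ℝ) (H : (EuclideanSpace ℝ (Fin 3)) → ℝ), 0 < r → 2 * r ≤ ρ →
      IntegrableOn H (ball c ρ) volume →
      (∀ φ : (EuclideanSpace ℝ (Fin 3)) → ℝ, ContDiff ℝ (⊤ : ℕ∞) φ → HasCompactSupport φ → tsupport φ ⊆ ball c ρ →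
        ∫ x, H x * (Δ φ) x = 0) →
      ∫⁻ x in ball c r, ‖H x - ⨍ y in ball c r, H y‖ₑ ^ (3 / 2 : ℝ) ≤
        C * ENNReal.ofReal (r ^ (9 / 2 : ℝ) / ρ ^ (9 / 2 : ℝ)) *
          ∫⁻ y in ball c ρ, ‖H y‖ₑ ^ (3 / 2 : ℝ) := by
  obtain ⟨K, hK0, hK⟩ := exists_lipschitz_rep_of_weaklyHarmonic_scale
  -- the constants
  set V₁ : ℝ≥0∞ := volume (ball (0 : (EuclideanSpace ℝ (Fin 3))) 1) with hV₁
  have hV₁t : V₁ ≠ ⊤ := measure_ball_lt_top.ne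
  set C₀ : ℝ≥0∞ := ENNReal.ofReal ((2 * K) ^ (3 / 2 : ℝ)) * (V₁ ^ (1 / 2 : ℝ) * V₁) with hC₀
  have hC₀t : C₀ ≠ ⊤ :=
    ENNReal.mul_ne_top ENNReal.ofReal_ne_top
      (ENNReal.mul_ne_top (ENNReal.rpow_ne_top_of_nonneg (by norm_num) hV₁t) hV₁t)
  refine ⟨C₀.toNNReal, fun c ρ r H hr hrρ hH hharm => ?_⟩
  rw [ENNReal.coe_toNNReal hC₀t]
  have hρ : 0 < ρ := by linarith
  have hrρ' : r ≤ ρ / 2 := by linarith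
  -- the Lipschitz representative on `B(c, ρ/2) ⊇ B(c, r)`
  obtain ⟨H', hH'c, hae, hLip⟩ := hK c ρ H hρ hH hharm
  set I : ℝ := ∫ y in ball c ρ, |H y| with hI
  have hI0 : 0 ≤ I := integral_nonneg fun y => abs_nonneg _
  set L : ℝ := K * (ρ ^ 4)⁻¹ * I with hL
  have hL0 : 0 ≤ L := by positivity
  have haer : H =ᵐ[volume.restrict (ball c r)] H' :=
    ae_restrict_of_ae_restrict_of_subset (ball_subset_ball hrρ') hae
  -- volumes of balls
  have hd : Module.finrank ℝ (EuclideanSpace ℝ (Fin 3)) = 3 := by simp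
  have hVr : volume (ball c r) = ENNReal.ofReal (r ^ 3) * V₁ := by
    rw [Measure.addHaar_ball_of_pos volume c hr, hd]
  have hVρ : volume (ball c ρ) = ENNReal.ofReal (ρ ^ 3) * V₁ := by
    rw [Measure.addHaar_ball_of_pos volume c hρ, hd]
  have hVr0 : volume.real (ball c r) ≠ 0 :=
    (ENNReal.toReal_pos (measure_ball_pos volume c hr).ne' measure_ball_lt_top.ne).ne'
  -- the oscillation of `H'` on `B(c, r)`
  have hH'i : IntegrableOn H' (ball c r) volume :=
    (hH'c.continuousOn.integrableOn_compact (isCompact_closedBall c r)).mono_set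
      ball_subset_closedBall
  have hosc : ∀ x ∈ ball c r, |H' x - ⨍ y in ball c r, H' y| ≤ 2 * r * L := by
    intro x hx
    have h1 : ⨍ y in ball c r, H' y = (volume.real (ball c r))⁻¹ * ∫ y in ball c r, H' y := by
      rw [setAverage_eq, smul_eq_mul]
    have h2 : H' x = (volume.real (ball c r))⁻¹ * ∫ _ in ball c r, H' x := by
      rw [setIntegral_const, smul_eq_mul, ← mul_assoc, inv_mul_cancel₀ hVr0, one_mul]
    have hci : IntegrableOn (fun _ : (EuclideanSpace ℝ (Fin 3)) => H' x) (ball c r) volume :=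
      integrableOn_const measure_ball_lt_top.ne
    have h3 : H' x - ⨍ y in ball c r, H' y =
        (volume.real (ball c r))⁻¹ * ∫ y in ball c r, (H' x - H' y) := by
      rw [integral_sub hci hH'i, mul_sub, ← h2, h1]
    have h4 : ‖∫ y in ball c r, (H' x - H' y)‖ ≤ 2 * r * L * volume.real (ball c r) := by
      refine norm_setIntegral_le_of_norm_le_const measure_ball_lt_top fun y hy => ?_
      rw [Real.norm_eq_abs]
      calc |H' x - H' y| ≤ K * (ρ ^ 4)⁻¹ * I * ‖x - y‖ := hLip x y
        _ ≤ K * (ρ ^ 4)⁻¹ * I * (2 * r) := by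
            refine mul_le_mul_of_nonneg_left ?_ (by positivity)
            calc ‖x - y‖ = dist x y := (dist_eq_norm x y).symm
              _ ≤ dist x c + dist y c := dist_triangle_right _ _ _
              _ ≤ 2 * r := by
                  rw [mem_ball] at hx hy
                  linarith
        _ = 2 * r * L := by rw [hL]; ring
    rw [h3, abs_mul, abs_inv, abs_of_nonneg measureReal_nonneg]
    calc (volume.real (ball c r))⁻¹ * |∫ y in ball c r, (H' x - H' y)|
        ≤ (volume.real (ball c r))⁻¹ * (2 * r * L * volume.real (ball c r)) := by
          refine mul_le_mul_of_nonneg_left ?_ (inv_nonneg.2 measureReal_nonneg)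
          rw [← Real.norm_eq_abs]
          exact h4
      _ = 2 * r * L := by field_simp
  -- the a.e. bound for `H` itself
  have havg : ⨍ y in ball c r, H y = ⨍ y in ball c r, H' y := average_congr haer
  have haeB : ∀ᵐ x ∂(volume.restrict (ball c r)),
      ‖H x - ⨍ y in ball c r, H y‖ₑ ^ (3 / 2 : ℝ) ≤ ENNReal.ofReal (2 * r * L) ^ (3 / 2 : ℝ) := by
    rw [havg]
    filter_upwards [haer, ae_restrict_mem measurableSet_ball] with x hx hxmem
    rw [hx]
    refine ENNReal.rpow_le_rpow ?_ (by norm_num)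
    rw [Real.enorm_eq_ofReal_abs]
    exact ENNReal.ofReal_le_ofReal (hosc x hxmem)
  -- `ofReal (2 r L) = ofReal (2 r K ρ⁻⁴) * ∫⁻_{B_ρ} ‖H‖ₑ`
  have hIeq : ENNReal.ofReal I = ∫⁻ y in ball c ρ, ‖H y‖ₑ := by
    have e : I = ∫ y in ball c ρ, ‖H y‖ := by
      simp only [hI, Real.norm_eq_abs]
    rw [e, ofReal_integral_norm_eq_lintegral_enorm hH]
  have h2rL : ENNReal.ofReal (2 * r * L) =
      ENNReal.ofReal (2 * r * K * (ρ ^ 4)⁻¹) * ∫⁻ y in ball c ρ, ‖H y‖ₑ := by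
    rw [← hIeq, ← ENNReal.ofReal_mul (by positivity), hL]
    ring_nf
  -- Hölder on `B(c, ρ)`
  have hHolder : (∫⁻ y in ball c ρ, ‖H y‖ₑ) ^ (3 / 2 : ℝ) ≤
      (volume (ball c ρ)) ^ (1 / 2 : ℝ) * ∫⁻ y in ball c ρ, ‖H y‖ₑ ^ (3 / 2 : ℝ) := by
    have h1 := lintegral_enorm_rpow_threeHalves_le (μ := volume.restrict (ball c ρ))
      hH.aestronglyMeasurable
    rwa [Measure.restrict_apply_univ] at h1
  -- assembly
  calc ∫⁻ x in ball c r, ‖H x - ⨍ y in ball c r, H y‖ₑ ^ (3 / 2 : ℝ)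
      ≤ ∫⁻ _ in ball c r, ENNReal.ofReal (2 * r * L) ^ (3 / 2 : ℝ) := lintegral_mono_ae haeB
    _ = ENNReal.ofReal (2 * r * L) ^ (3 / 2 : ℝ) * volume (ball c r) := setLIntegral_const _ _
    _ = ENNReal.ofReal (2 * r * K * (ρ ^ 4)⁻¹) ^ (3 / 2 : ℝ) *
          (∫⁻ y in ball c ρ, ‖H y‖ₑ) ^ (3 / 2 : ℝ) * volume (ball c r) := by
        rw [h2rL, ENNReal.mul_rpow_of_nonneg _ _ (by norm_num : (0 : ℝ) ≤ 3 / 2)]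
    _ ≤ ENNReal.ofReal (2 * r * K * (ρ ^ 4)⁻¹) ^ (3 / 2 : ℝ) *
          ((volume (ball c ρ)) ^ (1 / 2 : ℝ) * ∫⁻ y in ball c ρ, ‖H y‖ₑ ^ (3 / 2 : ℝ)) *
          volume (ball c r) := by
        gcongr
    _ = C₀ * ENNReal.ofReal (r ^ (9 / 2 : ℝ) / ρ ^ (9 / 2 : ℝ)) *
          ∫⁻ y in ball c ρ, ‖H y‖ₑ ^ (3 / 2 : ℝ) := by
        have key : ENNReal.ofReal ((2 * r * K * (ρ ^ 4)⁻¹) ^ (3 / 2 : ℝ)) *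
            ENNReal.ofReal ((ρ ^ 3) ^ (1 / 2 : ℝ)) * ENNReal.ofReal (r ^ 3) =
            ENNReal.ofReal ((2 * K) ^ (3 / 2 : ℝ)) *
              ENNReal.ofReal (r ^ (9 / 2 : ℝ) / ρ ^ (9 / 2 : ℝ)) := by
          rw [← ENNReal.ofReal_mul (by positivity), ← ENNReal.ofReal_mul (by positivity),
            rpow_oscillation_bookkeeping hK0 hr hρ, ENNReal.ofReal_mul (by positivity)]
        rw [hVr, hVρ, hC₀, ENNReal.mul_rpow_of_nonneg _ _ (by norm_num : (0 : ℝ) ≤ 1 / 2),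
          ENNReal.ofReal_rpow_of_nonneg (by positivity) (by norm_num : (0 : ℝ) ≤ 3 / 2),
          ENNReal.ofReal_rpow_of_nonneg (by positivity) (by norm_num : (0 : ℝ) ≤ 1 / 2)]
        calc ENNReal.ofReal ((2 * r * K * (ρ ^ 4)⁻¹) ^ (3 / 2 : ℝ)) *
              (ENNReal.ofReal ((ρ ^ 3) ^ (1 / 2 : ℝ)) * V₁ ^ (1 / 2 : ℝ) *
                ∫⁻ y in ball c ρ, ‖H y‖ₑ ^ (3 / 2 : ℝ)) * (ENNReal.ofReal (r ^ 3) * V₁)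
            = (ENNReal.ofReal ((2 * r * K * (ρ ^ 4)⁻¹) ^ (3 / 2 : ℝ)) *
                ENNReal.ofReal ((ρ ^ 3) ^ (1 / 2 : ℝ)) * ENNReal.ofReal (r ^ 3)) *
                (V₁ ^ (1 / 2 : ℝ) * V₁) * ∫⁻ y in ball c ρ, ‖H y‖ₑ ^ (3 / 2 : ℝ) := by ring
          _ = ENNReal.ofReal ((2 * K) ^ (3 / 2 : ℝ)) * (V₁ ^ (1 / 2 : ℝ) * V₁) *
                ENNReal.ofReal (r ^ (9 / 2 : ℝ) / ρ ^ (9 / 2 : ℝ)) *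
                ∫⁻ y in ball c ρ, ‖H y‖ₑ ^ (3 / 2 : ℝ) := by rw [key]; ring

end Literature.Analysis.FluidPDE

end
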